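import Summits.QuantumFields.BalabanUV.T4Continuum.Support.TorusSmallFieldGlobalGauge
import Summits.QuantumFields.BalabanUV.T4Continuum.Support.NE7EtaMinimiserGaugeCovariance
import Summits.QuantumFields.BalabanUV.T4Continuum.Support.NE7EtaBackgroundFlatOrbit
import Summits.QuantumFields.BalabanUV.T4Continuum.Support.MinimalActionWitness
import HarnessLib

/-!
# NE7DataExpChartGlobalGauge — EVERY SMALL DATUM IN THE SECTOR LIES, UP TO A PERIODIC GAUGE, IN THE EXPONENTIAL CHART AROUND THE FLAT DATUM
# (gen 26's `torusSmallFieldGlobalGauge` with the logarithm kept skew and periodic), AND ONE-STEP IS GAUGE-INVARIANT IN THE DATUM — so PATH costs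
# nothing for sector data: the path is `τ ↦ e^{τA}` in the global gauge

Cell `pub-balaban`, rung (B)+1 sub-cell t4, lineage `b2b-balaban-t4-ne7-p1`, generation 67 (CRUX PROVER NE7 #1); hunt (h11), memo
`t4/b2b-balaban-t4-ne7-p1-g67/HUNT-H11-NORMAL-CURRENCY.md` §3 (PATH).  File F22 (over gen 26's `TorusSmallFieldGlobalGauge.four_steps` and gen 5x's
`NE7EtaMinimiserGaugeCovariance.isMinimiser_gaugeAct`; consumed by F21 `NE7DataPathExp` ∕ F20 `NE7OneStepOfPathOpen`).

WHAT ([folklore]; 0 def, 0 sorry).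
§1 **`exists_expChart_of_sector`** (d = 4): a unitary `N`-periodic datum `V` with `SmallField V η`, `N ≥ 1`, in the sector `|n|·N²·η ≤ sectorConst n`,
   admits a unitary `N`-periodic site gauge `u` and a SKEW, `N`-PERIODIC `A` with `‖A x κ‖ ≤ gaugeConst n·(N⁻¹ + N·η)` and `V^u = flatCfg·e^{A}`
   bondwise (`gaugeAct u V = vary flatCfg A 1`) — `four_steps` + the logarithm of a unitary matrix TAKEN AS A FUNCTION OF THE BOND VALUE (so that `A` is
   periodic) with its Hermitian generator kept (so that `A = I•H` is skew).  Hence the exponential path `τ ↦ vary flatCfg (τ•A) 1` of F21 joins the flat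
   datum to `V^u` for EVERY sector datum: PATH is no longer a letter, up to the gauge `u`.
§2 **`oneStep_of_oneStep_gaugeAct`** (generic `d`, `L ≥ 1`, `LevelSmall` family): the ONE-STEP binder of `NE7InteriorInduction.interior_exists_all_levels`
   is GAUGE-INVARIANT IN THE DATUM — if it holds for `V^w` (`w` unitary `N`-periodic coarse gauge) it holds for `V`: minimisers are carried by the blown-up
   gauge ([tree] `isMinimiser_gaugeAct`, `mem_admissible_gaugeAct_datum`, `smallField_gaugeAct`, `gaugeAct_inv_gaugeAct`).
HONEST FRAMING (page 1).  Kinematics (a lattice gauge-fixing lemma of gen 26 and gauge covariance); nothing of OPEN ∕ REP_w ∕ APE; NOT ONE-STEP, NOT NE7;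
spine 0∕9; finite T⁴ rung (B)+1 — NOT infinite volume, NOT mass gap, NOT Clay.  Continuum YM on T⁴ ⇐ BetaPertH ∧ nine spine estimates (0/9 proved); BetaPertH
⇐ (D1) ∧ (D4) ∧ CAP+tail; G-an2-4 gates asym, D1 and NE2/3/4.
-/

set_option autoImplicit false

open scoped BigOperators Matrix Matrix.Norms.L2Operator Topology
open NormedSpace Finset Set Complex

namespace Summit.QuantumFields.BalabanUV.T4Continuum.NE7DataExpChartGlobalGauge

open Literature.MathematicalPhysics.QuantumFieldTheory.Balaban1983to89
open B7Prop1Explicit B7Prop2Explicit MatrixLog UnitaryModel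
open T4AveragingDeficitWall (IsUnitaryCfg IsSkewDir SmallField vary)
open T4AveragingDeficitWallBoundary (IsPeriodicCfg periodBox)
open AveragingDeficitPeriodicCounting (IsPeriodicDir)
open AveragingDeficitKDatum (isUnitaryCfg_gaugeAct gaugeAct_inv_gaugeAct)
open AveragingDeficitMultiLevelPrep (LevelSmall)
open MinimalActionSandwich (IsMinimiser admissible)
open MinimalActionRate (sfClass)
open MinimalActionWitness (flatCfg)
open NE3EnergyShapes (IsUnitarySite IsPeriodicSite)
open BlockAverageCurrent (smallField_gaugeAct)
open NE7EtaMinimiserGaugeCovariance (isMinimiser_gaugeAct mem_admissible_gaugeAct_datum isUnitarySite_inv isPeriodicSite_inv)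
open NE7EtaBackgroundFlatOrbit (isUnitarySite_blowup isPeriodicSite_blowup)
open UnitaryResolventMargin (marginConst marginConst_pos)
open TorusSmallFieldGlobalGauge (four_steps sigma0 Lambda0 sigma0_nonneg sectorConst gaugeConst isPeriodicCfg_gaugeAct)

noncomputable section

variable {n : Type*} [Fintype n] [DecidableEq n] [Nonempty n]

/-! ## §1 The exponential chart around the flat datum, in the global gauge -/

omit [Nonempty n] in
/-- The logarithm of a unitary matrix AS A FUNCTION of the unit: `I • H` with `H` the Hermitian generator of `MatrixLog.exists_isHermitian_exp_eq`
(`0` off the unitary group). [folklore] -/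
theorem exists_logFun : ∃ f : (Matrix n n ℂ)ˣ → Matrix n n ℂ, ∀ W : (Matrix n n ℂ)ˣ, (W : Matrix n n ℂ) ∈ unitary (Matrix n n ℂ) →
    f W ∈ skewAdjoint (Matrix n n ℂ) ∧ exp (f W) = (W : Matrix n n ℂ) ∧ ‖f W‖ ≤ Real.pi / 2 * ‖(W : Matrix n n ℂ) - 1‖ := by
  classical
  refine ⟨fun W => if h : (W : Matrix n n ℂ) ∈ unitary (Matrix n n ℂ) then I • Classical.choose (exists_isHermitian_exp_eq h) else 0, fun W hW => ?_⟩
  simp only [hW, dif_pos]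
  obtain ⟨hH, -, hexp, -, hle⟩ := Classical.choose_spec (exists_isHermitian_exp_eq hW)
  refine ⟨?_, hexp, ?_⟩
  · have hstar : star (Classical.choose (exists_isHermitian_exp_eq hW)) = Classical.choose (exists_isHermitian_exp_eq hW) := hH.eq
    rw [skewAdjoint.mem_iff, star_smul, Complex.star_def, Complex.conj_I, neg_smul, hstar]
  · rw [norm_smul, Complex.norm_I, one_mul]
    exact hle

/-- **EVERY SECTOR DATUM IS, UP TO A PERIODIC GAUGE, IN THE EXPONENTIAL CHART AROUND THE FLAT DATUM** (d = 4; `N ≥ 1`, `η ≥ 0`, `|n|·N²·η ≤ sectorConst n`):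
`∃ u` unitary `N`-periodic, `∃ A` skew `N`-periodic with `‖A x κ‖ ≤ gaugeConst n·(N⁻¹ + N·η)` and `gaugeAct u V = vary flatCfg A 1`. [folklore] -/
theorem exists_expChart_of_sector {N : ℕ} (hN : 1 ≤ N) {η : ℝ} (hη : 0 ≤ η) (hsec : (Fintype.card n : ℝ) * (N : ℝ) ^ 2 * η ≤ sectorConst n)
    {V : Site 4 → Fin 4 → (Matrix n n ℂ)ˣ} (hVu : IsUnitaryCfg V) (hVP : IsPeriodicCfg V (N : ℤ)) (hVη : SmallField V η) :
    ∃ u : Site 4 → (Matrix n n ℂ)ˣ, IsUnitarySite u ∧ IsPeriodicSite u (N : ℤ) ∧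
      ∃ A : Site 4 → Fin 4 → Matrix n n ℂ, IsSkewDir A ∧ IsPeriodicDir A (N : ℤ) ∧
        (∀ (x : Site 4) (κ : Fin 4), ‖A x κ‖ ≤ gaugeConst n * (((N : ℝ))⁻¹ + (N : ℝ) * η)) ∧
        gaugeAct u V = vary (flatCfg : Site 4 → Fin 4 → (Matrix n n ℂ)ˣ) A 1 := by
  have hsn := (marginConst_pos (n := n))
  have hc := sigma0_nonneg (n := n)
  have hK1 : (1 : ℝ) ≤ Fintype.card n := by exact_mod_cast Fintype.card_pos
  have hN0 : (0 : ℝ) < N := by exact_mod_cast hN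
  -- the sector condition in the form `8 N² η ≤ s_n` (as in `torusSmallFieldGlobalGauge_explicit`)
  have hsec' : 8 * ((N : ℝ) * (N * η)) ≤ marginConst n := by
    unfold TorusSmallFieldGlobalGauge.sectorConst at hsec
    have h1 : (N : ℝ) ^ 2 * η ≤ marginConst n / 8 := by
      have h2 : (Fintype.card n : ℝ) * ((N : ℝ) ^ 2 * η) ≤ (Fintype.card n : ℝ) * (marginConst n / 8) := by
        calc _ = (Fintype.card n : ℝ) * (N : ℝ) ^ 2 * η := by ring
          _ ≤ (Fintype.card n : ℝ) / 8 * marginConst n := hsec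
          _ = _ := by ring
      exact le_of_mul_le_mul_left h2 (by linarith)
    nlinarith
  obtain ⟨u, hu, huP, hbd⟩ := four_steps hN hVu hVP hη hVη hsec'
  obtain ⟨f, hf⟩ := exists_logFun (n := n)
  refine ⟨u, hu, huP, fun x κ => f (gaugeAct u V x κ), ?_, ?_, ?_, ?_⟩
  · intro x κ
    exact (hf _ (mem_unitaryUnits.mp (isUnitaryCfg_gaugeAct hu hVu x κ))).1
  · intro x i κ
    simp only [isPeriodicCfg_gaugeAct huP hVP x i κ]
  · intro x κ
    have hux : ((gaugeAct u V x κ : (Matrix n n ℂ)ˣ) : Matrix n n ℂ) ∈ unitary (Matrix n n ℂ) :=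
      mem_unitaryUnits.mp (isUnitaryCfg_gaugeAct hu hVu x κ)
    refine (hf _ hux).2.2.trans ?_
    refine (mul_le_mul_of_nonneg_left (hbd x κ) (by positivity)).trans ?_
    have hπ : Real.pi / 2 ≤ 2 := by linarith [Real.pi_lt_four]
    have hpos : 0 ≤ (243 + 40 * (1 + Lambda0 n)) * (N * η) + 40 * (sigma0 n / N) := by have := hc.1; have := hc.2; positivity
    calc Real.pi / 2 * ((243 + 40 * (1 + Lambda0 n)) * (N * η) + 40 * (sigma0 n / N))
        ≤ 2 * ((243 + 40 * (1 + Lambda0 n)) * (N * η) + 40 * (sigma0 n / N)) := mul_le_mul_of_nonneg_right hπ hpos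
      _ ≤ gaugeConst n * (((N : ℝ))⁻¹ + (N : ℝ) * η) := by
          unfold TorusSmallFieldGlobalGauge.gaugeConst
          have h1 : 0 ≤ (N : ℝ)⁻¹ := by positivity
          have h2 : 0 ≤ (N : ℝ) * η := by positivity
          have := hc.1; have := hc.2
          rw [div_eq_mul_inv]
          nlinarith
  · funext x κ
    refine Units.ext ?_
    have hux : ((gaugeAct u V x κ : (Matrix n n ℂ)ˣ) : Matrix n n ℂ) ∈ unitary (Matrix n n ℂ) :=
      mem_unitaryUnits.mp (isUnitaryCfg_gaugeAct hu hVu x κ)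
    have hexp := (hf _ hux).2.1
    simp only [vary, MinimalActionWitness.flatCfg, one_mul, val_expUnit, Complex.ofReal_one, one_smul]
    exact hexp.symm

/-! ## §2 ONE-STEP is gauge-invariant in the datum -/

variable {d : ℕ}

omit [Nonempty n] in
/-- The corner values of the blow-up `z ↦ w(⌊z∕L^{j+1}⌋)` of a coarse gauge `w` are `w` itself. [folklore] -/
theorem blowup_corner {L : ℕ} (hL : 1 ≤ L) (j : ℕ) (w : Site d → (Matrix n n ℂ)ˣ) :
    (fun y : Site d => (fun z : Site d => w (fun i => z i / ((L : ℤ) ^ (j + 1)))) ((((L : ℤ) ^ (j + 1))) • y)) = w := by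
  funext y
  have hLk : ((L : ℤ) ^ (j + 1)) ≠ 0 := pow_ne_zero _ (by exact_mod_cast (by omega : L ≠ 0))
  simp only [Pi.smul_apply, smul_eq_mul]
  congr 1
  funext i
  exact Int.mul_ediv_cancel_left _ hLk

/-- **THE ONE-STEP BINDER IS GAUGE-INVARIANT IN THE DATUM**: if, for the gauge-transformed datum `V^w` (`w` unitary, `N`-periodic), every level has the
ONE-STEP property (given an admissible competitor of radius `δ(L^k)^{−2}`, SOME constrained minimiser has radius `δ(L^{k+1})^{−2}`), then so does `V` —
competitors go to `V^w` and minimisers come back with the blown-up gauges `z ↦ w(⌊z∕L^{k+1}⌋)^{±1}`, which preserve the class, admissibility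
(`mem_admissible_gaugeAct_datum`), the action and the plaquette radius. [folklore] -/
theorem oneStep_of_oneStep_gaugeAct {L N : ℕ} (hL : 1 ≤ L) {ε δ : ℝ} (hε : 0 ≤ ε)
    (hls : ∀ k : ℕ, LevelSmall d L k (ε / ((L : ℝ) ^ (k + 1)) ^ 2)) {V : Site d → Fin d → (Matrix n n ℂ)ˣ}
    {w : Site d → (Matrix n n ℂ)ˣ} (hw : IsUnitarySite w) (hwP : IsPeriodicSite w (N : ℤ))
    (hstep : ∀ (k : ℕ) (U₀ : Site d → Fin d → (Matrix n n ℂ)ˣ), U₀ ∈ admissible (sfClass d L N ε) L (k + 1) (gaugeAct w V) →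
      SmallField U₀ (δ / ((L : ℝ) ^ k) ^ 2) →
      ∃ U, IsMinimiser d (sfClass d L N ε) L N (k + 1) (gaugeAct w V) U ∧ SmallField U (δ / ((L : ℝ) ^ (k + 1)) ^ 2)) :
    ∀ (k : ℕ) (U₀ : Site d → Fin d → (Matrix n n ℂ)ˣ), U₀ ∈ admissible (sfClass d L N ε) L (k + 1) V →
      SmallField U₀ (δ / ((L : ℝ) ^ k) ^ 2) →
      ∃ U, IsMinimiser d (sfClass d L N ε) L N (k + 1) V U ∧ SmallField U (δ / ((L : ℝ) ^ (k + 1)) ^ 2) := by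
  intro k U₀ hU₀ hU₀r
  -- the blown-up gauge and its inverse
  set ub : Site d → (Matrix n n ℂ)ˣ := fun z : Site d => w (fun i => z i / ((L : ℤ) ^ (k + 1))) with hub
  have hubu : IsUnitarySite ub := isUnitarySite_blowup hw L (k + 1)
  have hubP : IsPeriodicSite ub ((N * L ^ (k + 1) : ℕ) : ℤ) := isPeriodicSite_blowup hL hwP (k + 1)
  have hcorner : (fun y : Site d => ub ((((L : ℤ) ^ (k + 1))) • y)) = w := blowup_corner hL k w
  -- the competitor goes over
  have hU₀' : gaugeAct ub U₀ ∈ admissible (sfClass d L N ε) L (k + 1) (gaugeAct w V) := by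
    have h := mem_admissible_gaugeAct_datum hL hε k (hls k) hU₀ hubu hubP
    rw [hcorner] at h
    exact h
  obtain ⟨U, hmin, hUr⟩ := hstep k (gaugeAct ub U₀) hU₀' (smallField_gaugeAct hubu hU₀r)
  -- the minimiser comes back
  have hiu : IsUnitarySite fun z => (ub z)⁻¹ := isUnitarySite_inv hubu
  have hiP : IsPeriodicSite (fun z => (ub z)⁻¹) ((N * L ^ (k + 1) : ℕ) : ℤ) := isPeriodicSite_inv hubP
  have hback := isMinimiser_gaugeAct hL hε k (hls k) hmin hiu hiP
  have hdatum : gaugeAct (fun y : Site d => (fun z => (ub z)⁻¹) ((((L : ℤ) ^ (k + 1))) • y)) (gaugeAct w V) = V := by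
    have e : (fun y : Site d => (fun z => (ub z)⁻¹) ((((L : ℤ) ^ (k + 1))) • y)) = fun y => (w y)⁻¹ := by
      funext y
      have h := congrFun hcorner y
      simp only at h ⊢
      rw [h]
    rw [e]
    exact gaugeAct_inv_gaugeAct w V
  rw [hdatum] at hback
  exact ⟨gaugeAct (fun z => (ub z)⁻¹) U, hback, smallField_gaugeAct hiu hUr⟩

end

end Summit.QuantumFields.BalabanUV.T4Continuum.NE7DataExpChartGlobalGauge
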